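import Literature.NumberTheory.Automorphic.ArithmeticQuotientCohomologySemilinear
import HarnessLib

/-!
# `H^i(X_L, M₁ × M₂) ≅ H^i(X_L, M₁) × H^i(X_L, M₂)` and `H^i(X_L, M^J) ≅ H^i(X_L, M)^J`, Hecke-equivariantly

Topic `NumberTheory/Automorphic`; namespaces `Literature.Algebra.Homology` (two generic lemmas on the
tree's semilinear functoriality `semimap` of Mathlib's `groupCohomology`: additivity and the zero map)
and `Literature.NumberTheory.Automorphic.ArithmeticQuotient` (the cohomology
`H^i(X_L, M) = H^i(Γ, Fun(𝒢 ⧸ L, M))` of arithmetic quotients, `ArithmeticQuotientCohomology`).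
Definitions with bodies and theorems; no named fact, no instance, no `sorry`.

The cohomology of an arithmetic quotient is ADDITIVE in the coefficient module: for a finite family
of coefficient modules the projections and inclusions induce (by the functoriality
`ArithmeticQuotient.cohomologySemimap` of `ArithmeticQuotientCohomologySemilinear`, here with
`σ = id`) mutually inverse, HECKE-EQUIVARIANT linear isomorphisms

* `cohomologyProdEquiv : H^i(X_L, M₁ × M₂) ≃ₗ H^i(X_L, M₁) × H^i(X_L, M₂)`
  (`cohomologyProdEquiv_heckeEnd`), and
* `cohomologyPiEquiv : H^i(X_L, J → M) ≃ₗ (J → H^i(X_L, M))` for a finite index type `J`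
  (`cohomologyPiEquiv_heckeEnd`),

the standard consequence of the additivity of `H^i(Γ, −)` ([Brown1982CohomologyGroups, III.1 and
V.5]: `H^*(G, ⊕ M_j) = ⊕ H^*(G, M_j)` for finite sums).  Use in the tree: the pieces
`H^i(X_{U(r)}, ℤ/p^s)` of the Hida tower (`OrdinaryCompletedCohomologyGL`) versus cohomology with
coefficients in a finite free `ℤ/p^s`-algebra `𝒪/p^s ≅ (ℤ/p^s)^d` (the natural coefficients of the
independence-of-weight files), with matching Hecke operators (`…_heckeEnd`, `…_heckeEnd_pow`),
ordinary parts (`mem_iInf_range_pow_iff_pi`) and finiteness (`finite_cohomology_pi_iff`).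

## References

* K. S. Brown, *Cohomology of Groups*, GTM 87 (1982), III.1 (standard cochains), V.5 (additivity).
  [Brown1982CohomologyGroups]
-/

noncomputable section

open CategoryTheory groupCohomology

universe u

/-! ### Additivity of the semilinear functoriality of `groupCohomology` -/

namespace Literature.Algebra.Homology

variable {k k' : Type u} [CommRing k] [CommRing k'] {G : Type u} [Group G] {σ : k →+* k'}
  {A : Rep k G} {B : Rep k' G}

/-- **`Hⁿ(s + s') = Hⁿ(s) + Hⁿ(s')`** (additivity of the functoriality of group cohomology in the
coefficients: `(s + s') ∘ z = s ∘ z + s' ∘ z` on cocycles). [cite: Brown1982CohomologyGroups, V.5] -/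
theorem semimap_add (s s' : A.V →ₛₗ[σ] B.V) (hs : ∀ (g : G) (a : A.V), s (A.ρ g a) = B.ρ g (s a))
    (hs' : ∀ (g : G) (a : A.V), s' (A.ρ g a) = B.ρ g (s' a))
    (hss' : ∀ (g : G) (a : A.V), (s + s') (A.ρ g a) = B.ρ g ((s + s') a)) (n : ℕ)
    (x : groupCohomology A n) :
    semimap (s + s') hss' n x = semimap s hs n x + semimap s' hs' n x := by
  induction x using groupCohomology_induction_on with
  | h z =>
    rw [semimap_π, semimap_π, semimap_π, ← map_add]
    congr 1
    refine iCocycles_injective B n ?_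
    rw [map_add, iCocycles_cocyclesSemimap, iCocycles_cocyclesSemimap, iCocycles_cocyclesSemimap]
    funext g
    rfl

/-- A `G`-equivariance witness for `s + s'`. [folklore] -/
theorem add_equivariant {s s' : A.V →ₛₗ[σ] B.V} (hs : ∀ (g : G) (a : A.V), s (A.ρ g a) = B.ρ g (s a))
    (hs' : ∀ (g : G) (a : A.V), s' (A.ρ g a) = B.ρ g (s' a)) (g : G) (a : A.V) :
    (s + s') (A.ρ g a) = B.ρ g ((s + s') a) := by
  rw [LinearMap.add_apply, LinearMap.add_apply, hs, hs', map_add]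

/-- **`Hⁿ(0) = 0`.** [folklore] -/
theorem semimap_zero_map (h0 : ∀ (g : G) (a : A.V), (0 : A.V →ₛₗ[σ] B.V) (A.ρ g a) = B.ρ g ((0 : A.V →ₛₗ[σ] B.V) a))
    (n : ℕ) (x : groupCohomology A n) : semimap (0 : A.V →ₛₗ[σ] B.V) h0 n x = 0 := by
  induction x using groupCohomology_induction_on with
  | h z =>
    rw [semimap_π]
    have hz : cocyclesSemimap (0 : A.V →ₛₗ[σ] B.V) h0 n z = 0 := by
      refine iCocycles_injective B n ?_
      rw [iCocycles_cocyclesSemimap, map_zero]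
      funext g
      rfl
    rw [hz, map_zero]

/-- The zero map is `G`-equivariant. [folklore] -/
theorem zero_equivariant (g : G) (a : A.V) :
    (0 : A.V →ₛₗ[σ] B.V) (A.ρ g a) = B.ρ g ((0 : A.V →ₛₗ[σ] B.V) a) := by
  rw [LinearMap.zero_apply, LinearMap.zero_apply, map_zero]

/-- **`Hⁿ(∑ⱼ sⱼ) = ∑ⱼ Hⁿ(sⱼ)`** for a finite family of equivariant coefficient maps. [cite: Brown1982CohomologyGroups, V.5] -/
theorem semimap_sum {J : Type*} (t : Finset J) (s : J → (A.V →ₛₗ[σ] B.V))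
    (hs : ∀ (j : J) (g : G) (a : A.V), s j (A.ρ g a) = B.ρ g (s j a))
    (hsum : ∀ (g : G) (a : A.V), (∑ j ∈ t, s j) (A.ρ g a) = B.ρ g ((∑ j ∈ t, s j) a)) (n : ℕ)
    (x : groupCohomology A n) :
    semimap (∑ j ∈ t, s j) hsum n x = ∑ j ∈ t, semimap (s j) (hs j) n x := by
  classical
  induction t using Finset.induction_on with
  | empty =>
    conv_rhs => rw [Finset.sum_empty]
    refine Eq.trans (semimap_congr _ hsum _ zero_equivariant (fun a => ?_) n x)
      (semimap_zero_map (A := A) (B := B) (σ := σ) zero_equivariant n x)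
    rw [Finset.sum_empty]
  | insert j t hj ih =>
    conv_rhs => rw [Finset.sum_insert hj]
    have hsum' : ∀ (g : G) (a : A.V), (∑ j ∈ t, s j) (A.ρ g a) = B.ρ g ((∑ j ∈ t, s j) a) := by
      intro g a
      rw [LinearMap.sum_apply, LinearMap.sum_apply, map_sum]
      exact Finset.sum_congr rfl fun j _ => hs j g a
    rw [← ih hsum', ← semimap_add (s j) (∑ j ∈ t, s j) (hs j) hsum' (add_equivariant (hs j) hsum') n x]
    exact semimap_congr _ hsum _ _ (fun a => by rw [Finset.sum_insert hj]) n x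

end Literature.Algebra.Homology

/-! ### Binary products of coefficient modules -/

namespace Literature.NumberTheory.Automorphic.ArithmeticQuotient

open Literature.Algebra.Homology

variable (k : Type u) [CommRing k] {Γ 𝒢 : Type u} [Group Γ] [Group 𝒢] (ι : Γ →* 𝒢)
  (L : Subgroup 𝒢) (M₁ M₂ : Type u) [AddCommGroup M₁] [Module k M₁] [AddCommGroup M₂] [Module k M₂]
  (i : ℕ)

/-- `H^i(fst) : H^i(X_L, M₁ × M₂) → H^i(X_L, M₁)`. [folklore] -/
def cohomologyFst : cohomology k ι L (M₁ × M₂) i →ₗ[k] cohomology k ι L M₁ i :=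
  cohomologySemimap ι L (LinearMap.fst k M₁ M₂) i

/-- `H^i(snd) : H^i(X_L, M₁ × M₂) → H^i(X_L, M₂)`. [folklore] -/
def cohomologySnd : cohomology k ι L (M₁ × M₂) i →ₗ[k] cohomology k ι L M₂ i :=
  cohomologySemimap ι L (LinearMap.snd k M₁ M₂) i

/-- `H^i(inl) : H^i(X_L, M₁) → H^i(X_L, M₁ × M₂)`. [folklore] -/
def cohomologyInl : cohomology k ι L M₁ i →ₗ[k] cohomology k ι L (M₁ × M₂) i :=
  cohomologySemimap ι L (LinearMap.inl k M₁ M₂) i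

/-- `H^i(inr) : H^i(X_L, M₂) → H^i(X_L, M₁ × M₂)`. [folklore] -/
def cohomologyInr : cohomology k ι L M₂ i →ₗ[k] cohomology k ι L (M₁ × M₂) i :=
  cohomologySemimap ι L (LinearMap.inr k M₁ M₂) i

/-- `H^i(fst) ∘ H^i(inl) = id`. [folklore] -/
theorem cohomologyFst_cohomologyInl (x : cohomology k ι L M₁ i) :
    cohomologyFst k ι L M₁ M₂ i (cohomologyInl k ι L M₁ M₂ i x) = x := by
  unfold cohomologyFst cohomologyInl
  rw [cohomologySemimap_cohomologySemimap ι L _ _ (LinearMap.id : M₁ →ₗ[k] M₁) (fun m => rfl)]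
  exact cohomologySemimap_eq_self ι L _ (fun m => rfl) i x

/-- `H^i(snd) ∘ H^i(inr) = id`. [folklore] -/
theorem cohomologySnd_cohomologyInr (x : cohomology k ι L M₂ i) :
    cohomologySnd k ι L M₁ M₂ i (cohomologyInr k ι L M₁ M₂ i x) = x := by
  unfold cohomologySnd cohomologyInr
  rw [cohomologySemimap_cohomologySemimap ι L _ _ (LinearMap.id : M₂ →ₗ[k] M₂) (fun m => rfl)]
  exact cohomologySemimap_eq_self ι L _ (fun m => rfl) i x

/-- `H^i(fst) ∘ H^i(inr) = 0`. [folklore] -/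
theorem cohomologyFst_cohomologyInr (x : cohomology k ι L M₂ i) :
    cohomologyFst k ι L M₁ M₂ i (cohomologyInr k ι L M₁ M₂ i x) = 0 := by
  unfold cohomologyFst cohomologyInr
  rw [cohomologySemimap_cohomologySemimap ι L _ _ (0 : M₂ →ₗ[k] M₁) (fun m => rfl)]
  exact semimap_zero_map _ i x

/-- `H^i(snd) ∘ H^i(inl) = 0`. [folklore] -/
theorem cohomologySnd_cohomologyInl (x : cohomology k ι L M₁ i) :
    cohomologySnd k ι L M₁ M₂ i (cohomologyInl k ι L M₁ M₂ i x) = 0 := by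
  unfold cohomologySnd cohomologyInl
  rw [cohomologySemimap_cohomologySemimap ι L _ _ (0 : M₁ →ₗ[k] M₂) (fun m => rfl)]
  exact semimap_zero_map _ i x

/-- **`H^i(inl) ∘ H^i(fst) + H^i(inr) ∘ H^i(snd) = id`** (additivity of `H^i(X_L, −)`).
[cite: Brown1982CohomologyGroups, V.5] -/
theorem cohomologyInl_fst_add_cohomologyInr_snd (x : cohomology k ι L (M₁ × M₂) i) :
    cohomologyInl k ι L M₁ M₂ i (cohomologyFst k ι L M₁ M₂ i x) +
      cohomologyInr k ι L M₁ M₂ i (cohomologySnd k ι L M₁ M₂ i x) = x := by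
  unfold cohomologyInl cohomologyFst cohomologyInr cohomologySnd
  rw [cohomologySemimap_cohomologySemimap ι L _ _ ((LinearMap.inl k M₁ M₂) ∘ₗ LinearMap.fst k M₁ M₂)
      (fun m => rfl),
    cohomologySemimap_cohomologySemimap ι L _ _ ((LinearMap.inr k M₁ M₂) ∘ₗ LinearMap.snd k M₁ M₂)
      (fun m => rfl)]
  unfold cohomologySemimap
  -- the two coefficient maps and their sum, as equivariant maps of `Fun(𝒢 ⧸ L, M₁ × M₂)`
  set R : Rep k Γ := coeffRep k ι L (M₁ × M₂) with hR
  set S₁ : R.V →ₗ[k] R.V := coeffSemimap L ((LinearMap.inl k M₁ M₂) ∘ₗ LinearMap.fst k M₁ M₂) with hS₁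
  set S₂ : R.V →ₗ[k] R.V := coeffSemimap L ((LinearMap.inr k M₁ M₂) ∘ₗ LinearMap.snd k M₁ M₂) with hS₂
  have h₁ : ∀ (g : Γ) (a : R.V), S₁ (R.ρ g a) = R.ρ g (S₁ a) :=
    coeffSemimap_coeffRepresentation ι L ((LinearMap.inl k M₁ M₂) ∘ₗ LinearMap.fst k M₁ M₂)
  have h₂ : ∀ (g : Γ) (a : R.V), S₂ (R.ρ g a) = R.ρ g (S₂ a) :=
    coeffSemimap_coeffRepresentation ι L ((LinearMap.inr k M₁ M₂) ∘ₗ LinearMap.snd k M₁ M₂)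
  have hid : ∀ (g : Γ) (a : R.V), (coeffSemimap L (LinearMap.id : (M₁ × M₂) →ₗ[k] (M₁ × M₂))) (R.ρ g a) =
      R.ρ g ((coeffSemimap L (LinearMap.id : (M₁ × M₂) →ₗ[k] (M₁ × M₂))) a) :=
    coeffSemimap_coeffRepresentation ι L _
  change semimap (A := R) (B := R) S₁ h₁ i x + semimap (A := R) (B := R) S₂ h₂ i x = x
  rw [← semimap_add (A := R) (B := R) S₁ S₂ h₁ h₂ (add_equivariant (A := R) (B := R) h₁ h₂) i x]
  refine Eq.trans (semimap_congr (A := R) (B := R) (S₁ + S₂) (add_equivariant (A := R) (B := R) h₁ h₂)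
    (coeffSemimap L (LinearMap.id : (M₁ × M₂) →ₗ[k] (M₁ × M₂))) hid (fun f => funext fun c => ?_) i x)
    (semimap_eq_self (A := R) _ hid (fun f => rfl) i x)
  change ((f c).1, (0 : M₂)) + ((0 : M₁), (f c).2) = f c
  rw [Prod.mk_add_mk, add_zero, zero_add]

/-- **`H^i(X_L, M₁ × M₂) ≃ H^i(X_L, M₁) × H^i(X_L, M₂)`** (projections; inverse the sum of the
inclusions). [cite: Brown1982CohomologyGroups, V.5] -/
def cohomologyProdEquiv :
    cohomology k ι L (M₁ × M₂) i ≃ₗ[k] cohomology k ι L M₁ i × cohomology k ι L M₂ i :=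
  LinearEquiv.ofLinear
    ((cohomologyFst k ι L M₁ M₂ i).prod (cohomologySnd k ι L M₁ M₂ i))
    ((cohomologyInl k ι L M₁ M₂ i).coprod (cohomologyInr k ι L M₁ M₂ i))
    (LinearMap.ext fun y => Prod.ext
      (by simp [map_add, cohomologyFst_cohomologyInl, cohomologyFst_cohomologyInr])
      (by simp [map_add, cohomologySnd_cohomologyInl, cohomologySnd_cohomologyInr]))
    (LinearMap.ext fun x => by
      simpa using cohomologyInl_fst_add_cohomologyInr_snd k ι L M₁ M₂ i x)

/-- Unfolding lemma for `cohomologyProdEquiv`. [folklore] -/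
@[simp]
theorem cohomologyProdEquiv_apply (x : cohomology k ι L (M₁ × M₂) i) :
    cohomologyProdEquiv k ι L M₁ M₂ i x =
      (cohomologyFst k ι L M₁ M₂ i x, cohomologySnd k ι L M₁ M₂ i x) :=
  rfl

/-- Unfolding lemma for the inverse of `cohomologyProdEquiv`. [folklore] -/
@[simp]
theorem cohomologyProdEquiv_symm_apply (y : cohomology k ι L M₁ i × cohomology k ι L M₂ i) :
    (cohomologyProdEquiv k ι L M₁ M₂ i).symm y =
      cohomologyInl k ι L M₁ M₂ i y.1 + cohomologyInr k ι L M₁ M₂ i y.2 :=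
  rfl

/-- **Hecke-equivariance of `cohomologyProdEquiv`**: `T_g` on `H^i(X_L, M₁ × M₂)` is `T_g × T_g`.
[folklore] -/
theorem cohomologyProdEquiv_heckeEnd (g : 𝒢) (x : cohomology k ι L (M₁ × M₂) i) :
    cohomologyProdEquiv k ι L M₁ M₂ i (heckeEnd k L g (M₁ × M₂) ι i x) =
      (heckeEnd k L g M₁ ι i ((cohomologyProdEquiv k ι L M₁ M₂ i x).1),
        heckeEnd k L g M₂ ι i ((cohomologyProdEquiv k ι L M₁ M₂ i x).2)) := by
  rw [cohomologyProdEquiv_apply, cohomologyProdEquiv_apply]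
  exact Prod.ext (cohomologySemimap_heckeEnd ι L _ g i x) (cohomologySemimap_heckeEnd ι L _ g i x)

/-- The same for powers of `T_g`. [folklore] -/
theorem cohomologyProdEquiv_heckeEnd_pow (g : 𝒢) (n : ℕ) (x : cohomology k ι L (M₁ × M₂) i) :
    cohomologyProdEquiv k ι L M₁ M₂ i ((heckeEnd k L g (M₁ × M₂) ι i ^ n) x) =
      ((heckeEnd k L g M₁ ι i ^ n) ((cohomologyProdEquiv k ι L M₁ M₂ i x).1),
        (heckeEnd k L g M₂ ι i ^ n) ((cohomologyProdEquiv k ι L M₁ M₂ i x).2)) := by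
  induction n generalizing x with
  | zero => simp
  | succ n ih =>
    rw [pow_succ, pow_succ, pow_succ, Module.End.mul_apply, Module.End.mul_apply, Module.End.mul_apply,
      ih, cohomologyProdEquiv_heckeEnd]

/-! ### Finite products of one coefficient module -/

variable {J : Type u} [Fintype J] [DecidableEq J] (M : Type u) [AddCommGroup M] [Module k M]

/-- `H^i(proj_j) : H^i(X_L, J → M) → H^i(X_L, M)`. [folklore] -/
def cohomologyProj (j : J) : cohomology k ι L (J → M) i →ₗ[k] cohomology k ι L M i :=
  cohomologySemimap ι L (LinearMap.proj j : (J → M) →ₗ[k] M) i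

/-- `H^i(single_j) : H^i(X_L, M) → H^i(X_L, J → M)`. [folklore] -/
def cohomologySingle (j : J) : cohomology k ι L M i →ₗ[k] cohomology k ι L (J → M) i :=
  cohomologySemimap ι L (LinearMap.single k (fun _ : J => M) j) i

omit [Fintype J] in
/-- `H^i(proj_j) ∘ H^i(single_j) = id`. [folklore] -/
theorem cohomologyProj_cohomologySingle_self (j : J) (x : cohomology k ι L M i) :
    cohomologyProj k ι L i M j (cohomologySingle k ι L i M j x) = x := by
  unfold cohomologyProj cohomologySingle
  rw [cohomologySemimap_cohomologySemimap ι L _ _ (LinearMap.id : M →ₗ[k] M)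
    (fun m => by simp)]
  exact cohomologySemimap_eq_self ι L _ (fun m => rfl) i x

omit [Fintype J] in
/-- `H^i(proj_j) ∘ H^i(single_{j'}) = 0` for `j ≠ j'`. [folklore] -/
theorem cohomologyProj_cohomologySingle_of_ne {j j' : J} (h : j ≠ j') (x : cohomology k ι L M i) :
    cohomologyProj k ι L i M j (cohomologySingle k ι L i M j' x) = 0 := by
  unfold cohomologyProj cohomologySingle
  rw [cohomologySemimap_cohomologySemimap ι L _ _ (0 : M →ₗ[k] M)
    (fun m => by simp [Pi.single_eq_of_ne h])]
  exact semimap_zero_map _ i x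

/-- **`∑ⱼ H^i(single_j) ∘ H^i(proj_j) = id`** (additivity of `H^i(X_L, −)`).
[cite: Brown1982CohomologyGroups, V.5] -/
theorem sum_cohomologySingle_cohomologyProj (x : cohomology k ι L (J → M) i) :
    ∑ j, cohomologySingle k ι L i M j (cohomologyProj k ι L i M j x) = x := by
  unfold cohomologySingle cohomologyProj
  have hcomp : ∀ j, cohomologySemimap ι L (LinearMap.single k (fun _ : J => M) j) i
      (cohomologySemimap ι L (LinearMap.proj j : (J → M) →ₗ[k] M) i x) =
      cohomologySemimap ι L ((LinearMap.single k (fun _ : J => M) j) ∘ₗ (LinearMap.proj j)) i x :=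
    fun j => cohomologySemimap_cohomologySemimap ι L _ _ _ (fun m => rfl) i x
  simp_rw [hcomp]
  unfold cohomologySemimap
  set R : Rep k Γ := coeffRep k ι L (J → M) with hR
  set S : J → (R.V →ₗ[k] R.V) :=
    fun j => coeffSemimap L ((LinearMap.single k (fun _ : J => M) j) ∘ₗ (LinearMap.proj j)) with hS
  have hs : ∀ (j : J) (g : Γ) (a : R.V), S j (R.ρ g a) = R.ρ g (S j a) :=
    fun j => coeffSemimap_coeffRepresentation ι L _
  have hsum : ∀ (g : Γ) (a : R.V), (∑ j ∈ Finset.univ, S j) (R.ρ g a) = R.ρ g ((∑ j ∈ Finset.univ, S j) a) := by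
    intro g a
    rw [LinearMap.sum_apply, LinearMap.sum_apply, map_sum]
    exact Finset.sum_congr rfl fun j _ => hs j g a
  have hid : ∀ (g : Γ) (a : R.V), (coeffSemimap L (LinearMap.id : (J → M) →ₗ[k] (J → M))) (R.ρ g a) =
      R.ρ g ((coeffSemimap L (LinearMap.id : (J → M) →ₗ[k] (J → M))) a) :=
    coeffSemimap_coeffRepresentation ι L _
  change ∑ j, semimap (A := R) (B := R) (S j) (hs j) i x = x
  rw [← semimap_sum (A := R) (B := R) Finset.univ S hs hsum i x]
  refine Eq.trans (semimap_congr (A := R) (B := R) _ hsum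
    (coeffSemimap L (LinearMap.id : (J → M) →ₗ[k] (J → M))) hid (fun f => funext fun c => ?_) i x)
    (semimap_eq_self (A := R) _ hid (fun f => rfl) i x)
  rw [LinearMap.sum_apply, Finset.sum_apply]
  exact Finset.univ_sum_single (f c)

/-- `H^i(proj_j) (∑ⱼ' H^i(single_{j'}) (y j')) = y j`. [folklore] -/
theorem cohomologyProj_sum_cohomologySingle (y : J → cohomology k ι L M i) (j : J) :
    cohomologyProj k ι L i M j (∑ j', cohomologySingle k ι L i M j' (y j')) = y j := by
  rw [map_sum, Finset.sum_eq_single j (fun j' _ hj' =>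
      cohomologyProj_cohomologySingle_of_ne k ι L i M (Ne.symm hj') (y j'))
    (fun h => absurd (Finset.mem_univ j) h), cohomologyProj_cohomologySingle_self]

/-- **`H^i(X_L, J → M) ≃ (J → H^i(X_L, M))`** for a finite index type `J` (projections; inverse the
sum of the inclusions). [cite: Brown1982CohomologyGroups, V.5] -/
def cohomologyPiEquiv : cohomology k ι L (J → M) i ≃ₗ[k] (J → cohomology k ι L M i) :=
  LinearEquiv.ofLinear
    (LinearMap.pi fun j => cohomologyProj k ι L i M j)
    (∑ j, (cohomologySingle k ι L i M j) ∘ₗ (LinearMap.proj j))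
    (LinearMap.ext fun y => funext fun j => by
      change cohomologyProj k ι L i M j ((∑ j', cohomologySingle k ι L i M j' ∘ₗ LinearMap.proj j') y) = y j
      rw [LinearMap.sum_apply]
      simp only [LinearMap.coe_comp, Function.comp_apply, LinearMap.coe_proj, Function.eval]
      exact cohomologyProj_sum_cohomologySingle k ι L i M y j)
    (LinearMap.ext fun x => by
      change (∑ j, cohomologySingle k ι L i M j ∘ₗ LinearMap.proj j)
        (LinearMap.pi (fun j => cohomologyProj k ι L i M j) x) = x
      rw [LinearMap.sum_apply]
      simp only [LinearMap.coe_comp, Function.comp_apply, LinearMap.coe_proj, Function.eval,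
        LinearMap.pi_apply]
      exact sum_cohomologySingle_cohomologyProj k ι L i M x)

/-- Unfolding lemma for `cohomologyPiEquiv`. [folklore] -/
@[simp]
theorem cohomologyPiEquiv_apply (x : cohomology k ι L (J → M) i) (j : J) :
    cohomologyPiEquiv k ι L i M x j = cohomologyProj k ι L i M j x :=
  rfl

/-- **Hecke-equivariance of `cohomologyPiEquiv`**: `T_g` on `H^i(X_L, J → M)` is `T_g` in each
coordinate. [folklore] -/
theorem cohomologyPiEquiv_heckeEnd (g : 𝒢) (x : cohomology k ι L (J → M) i) (j : J) :
    cohomologyPiEquiv k ι L i M (heckeEnd k L g (J → M) ι i x) j =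
      heckeEnd k L g M ι i (cohomologyPiEquiv k ι L i M x j) := by
  rw [cohomologyPiEquiv_apply, cohomologyPiEquiv_apply]
  exact cohomologySemimap_heckeEnd ι L _ g i x

/-- The same for powers of `T_g`. [folklore] -/
theorem cohomologyPiEquiv_heckeEnd_pow (g : 𝒢) (n : ℕ) (x : cohomology k ι L (J → M) i) (j : J) :
    cohomologyPiEquiv k ι L i M ((heckeEnd k L g (J → M) ι i ^ n) x) j =
      (heckeEnd k L g M ι i ^ n) (cohomologyPiEquiv k ι L i M x j) := by
  induction n generalizing x with
  | zero => simp
  | succ n ih =>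
    rw [pow_succ, pow_succ, Module.End.mul_apply, Module.End.mul_apply, ih, cohomologyPiEquiv_heckeEnd]

/-- **Ordinary parts match**: `x ∈ ⋂ₙ range T_gⁿ` on `H^i(X_L, J → M)` iff every coordinate of `Φ x`
lies in `⋂ₙ range T_gⁿ` on `H^i(X_L, M)`. [folklore] -/
theorem mem_iInf_range_pow_iff_pi (g : 𝒢) (x : cohomology k ι L (J → M) i) :
    x ∈ (⨅ n : ℕ, LinearMap.range (heckeEnd k L g (J → M) ι i ^ n)) ↔
      ∀ j, cohomologyPiEquiv k ι L i M x j ∈ (⨅ n : ℕ, LinearMap.range (heckeEnd k L g M ι i ^ n)) := by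
  simp only [Submodule.mem_iInf, LinearMap.mem_range]
  constructor
  · rintro h j n
    obtain ⟨y, rfl⟩ := h n
    exact ⟨cohomologyPiEquiv k ι L i M y j, (cohomologyPiEquiv_heckeEnd_pow k ι L i M g n y j).symm⟩
  · intro h n
    choose y hy using fun j => h j n
    refine ⟨(cohomologyPiEquiv k ι L i M).symm y, ?_⟩
    apply (cohomologyPiEquiv k ι L i M).injective
    funext j
    rw [cohomologyPiEquiv_heckeEnd_pow, LinearEquiv.apply_symm_apply, hy]

/-- **Finiteness matches**: `H^i(X_L, J → M)` is finite iff `H^i(X_L, M)` is (for `J` finite and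
non-empty). [folklore] -/
theorem finite_cohomology_pi_iff [Nonempty J] :
    Finite (cohomology k ι L (J → M) i) ↔ Finite (cohomology k ι L M i) := by
  rw [Equiv.finite_iff (cohomologyPiEquiv k ι L i M).toEquiv]
  constructor
  · intro h
    obtain ⟨j⟩ := ‹Nonempty J›
    exact Finite.of_surjective (fun f : J → cohomology k ι L M i => f j)
      fun y => ⟨fun _ => y, rfl⟩
  · intro h
    exact Pi.finite

end Literature.NumberTheory.Automorphic.ArithmeticQuotient
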